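import Summits.QuantumFields.YangMills.Theorems.BalabanUVNodesN19ExpectationCurrencyTwoConstantsAtScheme

/-!
# YM-DAG node N19 (= NE7 proper) — THE EXPECTATION CURRENCY OF THE NODE's DECL TARGET, III: TWO CONSTANTS, THE RATE UNDER `Target` ALONE — for a
# string whose dressed partition functions match modulo constants with a SUMMABLE remainder (`Spine.NE7.Target vol l₀ δ (schemeZ S os)`, N19's DECL
# target, nothing more) the expectations converge and `|⟨∏os⟩_K − lim| ≤ (4·e^{1+l₀}∕l₀)·τ_K·(1 + log⁺ τ_K⁻¹)`, `τ_K = Σ_m 2·vol·δ_{K+m}` the tree's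
# generating-function tail — NO extra summability hypothesis (neither the √-road's `Σ√δ_K < ∞` nor the sibling's `Σ δ_K(1 + log⁺ δ_K⁻¹) < ∞`)

Cell `pub-ymgap`, HUMAN RULING D-0062 (Track A), R141 (C) wider-strategy seat `pub-ymgap-dag-n19-e` (strategy s3 = ALTERNATIVE CURRENCY), seventh module of the
seat; closes the expectation-currency line of the siblings `…N19ExpectationCurrency` (p477102, Landau, price √) ∕ `…AtScheme` (p477267) ∕ `…TwoConstants` (p480837,
two constants ⇒ linear-log price for ε-close cgf's) ∕ `…TwoConstantsAtScheme` (p481156, one-step increments and `ExpectCauchyRate`).  Route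
`Summits/QuantumFields/YangMills/Theses/BalabanUVNodes.lean` rev 15, cluster item K3′ «SpineGivenEndpointR12» (stmt-QuantumFields-19908); filed `--supports` that
item `--as helper` (it proves no registered stub).  COUNT-NEUTRAL: bookkeeping BY NAME over the tree's scheme objects and the siblings + elementary real analysis;
NOT a discharge claim.

THE POINT.  The one-step road (increments `K → K+1`, then a telescoping sum) needs the one-step bounds to be summable — hence the displayed extra
hypotheses of the siblings.  The two-constants bound is NOT additive in `ε`, so it pays to apply it ONCE to the pair `(K, K+n)`: the cgf's of `F_K` and
`F_{K+n}` are `τ_K`-close on the real segment for EVERY `n` (`τ_K = Σ_m 2·vol·δ_{K+m}`, the tail of `T4CauchySum.abs_genFun_sub_lim_le`; here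
`abs_genFun_add_sub_le_tail`), so the analysis half gives `|⟨F_{K+n}⟩ − ⟨F_K⟩| ≤ (4e^{1+l₀}∕l₀)·τ_K·(1 + log⁺ τ_K⁻¹)` UNIFORMLY IN `n`; `Summable δ` alone
sends `τ_K → 0` (Mathlib `tendsto_sum_nat_add`), hence the bound to `0` (`x·(1 + log⁺ x⁻¹) ≤ x + 2√x`), hence the expectations are Cauchy and the
bound passes to the limit.  Consequently N19's DECL target, string by string and with NO common remainder, gives the continuum limit of that string's
expectations WITH AN EXPLICIT RATE; the apex's `T4ApexVariance.StringwiseMatching S` gives `HasContinuumLimit S` (qualitatively the tree's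
`T4ApexVariance.hasContinuumLimit_of_stringwiseMatching`, genFun ∕ Vitali road — credited, not re-derived as new) now WITH per-string rates.

WHAT IS KERNEL-CHECKED (0 `def`, 0 `sorry`).
* §5.1 [folklore] `abs_genFun_add_sub_le_tail` (`MatchingModConstants`, `Summable δ` ⇒ `|genFun Z (K+n) t − genFun Z K t| ≤ Σ_m 2·vol·δ_{K+m}` on
  `|t| ≤ l₀`, every `n`; Mathlib `dist_le_Ico_sum_of_dist_le` + `Summable.sum_le_tsum`) · `tendsto_linlog_of_tendsto_zero` (`u_K ≥ 0`, `u_K → 0` ⇒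
  `C·u_K·(1 + log⁺ u_K⁻¹) → 0`, by the sibling's `mul_posLog_inv_le_two_sqrt`).
* §5.2 AT THE SCHEME [bookkeeping]: `abs_expectAt_add_sub_le_linlog_tail` (the display for the pair `(K, K+n)`, uniformly in `n`) ·
  `abs_expectAt_sub_lim_le_linlog_tail_of_target` (**`Spine.NE7.Target vol l₀ δ (schemeZ S os)`, `0 < l₀` ⇒ ∃ E, `S.expectAt K os → E` AND
  `|S.expectAt K os − E| ≤ (4e^{1+l₀}∕l₀)·τ_K·(1 + log⁺ τ_K⁻¹)` for EVERY `K`**) · `stringwise_rate_of_stringwiseMatching` (`T4ApexVariance.StringwiseMatching S` ⇒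
  per string: its own `l₀, vol, δ`, a limit, and this rate) · `hasContinuumLimit_of_stringwiseMatching_twoConstants` (⇒ `Missing.HasContinuumLimit S`; the
  same conclusion as the tree's `T4ApexVariance.hasContinuumLimit_of_stringwiseMatching` by a different road — recorded only as a cross-check, no novelty claimed).

HONEST FRAMING.  NE7 ∕ NE7b ∕ NE7c are NOT PRINTED ([Balaban1987RG1]–[Balaban1989LargeFieldII] bound ONE run uniformly in `ε`; printed template [King1986]
(3.10)–(3.13) pp. 656–657, context only) and NOT PROVED; `Target` ∕ `MatchingModConstants` ∕ `StringwiseMatching` occur as HYPOTHESES only; nothing of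
Bałaban's is asserted or instantiated; N19 is NOT discharged; K3′ is NOT claimed; Track A count unmoved (typed 28∕28 · discharged 5∕27 · A 5∕28).  For
geometric remainders `δ_K ≤ C·θ^K` the rate reads `O(K·θ^K)`; for `δ_K = (K+1)⁻²` it reads `O(log K ∕ K)`; whether the logarithm can be removed from the
RATE under `Target` alone is NOT decided here.  One finite four-torus at fixed ε, rung (B)+1 — NOT infinite volume, NOT OS on ℝ⁴, NOT a mass gap, NOT Clay.
THEOREMS ONLY; 0 sorry; standard axioms.  No decl below carries a cite tag.
-/

set_option autoImplicit false

noncomputable section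

open Set Metric Filter Topology MeasureTheory ProbabilityTheory
open scoped BigOperators

namespace Summit.QuantumFields.YangMills.BalabanUVNodes.N19ExpectationCurrencyTwoConstantsRate

open Literature.MathematicalPhysics.QuantumFieldTheory.Balaban1983to89
open T4CauchySum (MatchingModConstants genFun abs_genFun_succ_sub_le)
open T4GenFunBounds (schemeZ prodObs)
open Missing (TorusScheme HasContinuumLimit)
open Summit.QuantumFields.BalabanUV.T4Continuum.Spine
open Summit.QuantumFields.YangMills.BalabanUVNodes.N19ExpectationCurrencyAtScheme (mul_nonneg_of_matchingModConstants)
open Summit.QuantumFields.YangMills.BalabanUVNodes.N19ExpectationCurrencyTwoConstants (abs_integral_sub_integral_le_linlog_of_cgf_close)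
open Summit.QuantumFields.YangMills.BalabanUVNodes.N19ExpectationCurrencyTwoConstantsAtScheme (mul_posLog_inv_le_two_sqrt)

/-! ## §5.1 The generating-function tail bounds every pair `(K, K+n)`; the linear-log bound tends to zero [folklore] -/

section Tail

/-- Under `MatchingModConstants vol l₀ δ Z` with `Summable δ`, for every `K`, `n` and `|t| ≤ l₀`:
`|genFun Z (K+n) t − genFun Z K t| ≤ Σ_m 2·vol·δ_{K+m}` — the tree's tail (`T4CauchySum.abs_genFun_sub_lim_le`) for two finite indices
(Mathlib `dist_le_Ico_sum_of_dist_le`, `Finset.sum_Ico_eq_sum_range`, `Summable.sum_le_tsum`; the terms are `≥ 0` by `mul_nonneg_of_matchingModConstants`).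
[folklore] -/
theorem abs_genFun_add_sub_le_tail {vol l₀ : ℝ} {δ : ℕ → ℝ} {Z : ℕ → ℝ → ℝ} (h : MatchingModConstants vol l₀ δ Z)
    (hl₀ : 0 ≤ l₀) (hδ : Summable δ) {t : ℝ} (ht : |t| ≤ l₀) (K n : ℕ) :
    |genFun Z (K + n) t - genFun Z K t| ≤ ∑' m, 2 * (vol * δ (K + m)) := by
  have hnn : ∀ j, 0 ≤ 2 * (vol * δ j) := fun j => mul_nonneg two_pos.le (mul_nonneg_of_matchingModConstants hl₀ h j)
  have hstep : ∀ k, dist (genFun Z k t) (genFun Z (k + 1) t) ≤ 2 * (vol * δ k) := fun k => by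
    rw [Real.dist_eq, abs_sub_comm]
    exact abs_genFun_succ_sub_le h hl₀ k ht
  have hd : dist (genFun Z K t) (genFun Z (K + n) t) ≤ ∑ i ∈ Finset.Ico K (K + n), 2 * (vol * δ i) :=
    dist_le_Ico_sum_of_dist_le (Nat.le_add_right K n) fun {k} _ _ => hstep k
  rw [Real.dist_eq, abs_sub_comm, Finset.sum_Ico_eq_sum_range, Nat.add_sub_cancel_left] at hd
  have hs : Summable fun m => 2 * (vol * δ (K + m)) :=
    ((hδ.mul_left vol).mul_left 2).comp_injective (add_right_injective K)
  exact hd.trans (hs.sum_le_tsum (Finset.range n) fun m _ => hnn (K + m))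

/-- If `0 ≤ u_K → 0` then `C·u_K·(1 + log⁺ u_K⁻¹) → 0` (squeeze with `u·(1 + log⁺ u⁻¹) ≤ u + 2√u`, the sibling's `mul_posLog_inv_le_two_sqrt`).
[folklore] -/
theorem tendsto_linlog_of_tendsto_zero {u : ℕ → ℝ} (hu0 : ∀ K, 0 ≤ u K) (hu : Tendsto u atTop (𝓝 0)) (C : ℝ) :
    Tendsto (fun K => C * u K * (1 + Real.posLog (u K)⁻¹)) atTop (𝓝 0) := by
  have hg : Tendsto (fun K => u K + 2 * Real.sqrt (u K)) atTop (𝓝 0) := by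
    have hs : Tendsto (fun K => Real.sqrt (u K)) atTop (𝓝 0) := by
      have := (Real.continuous_sqrt.tendsto 0).comp hu
      rwa [Function.comp_def, Real.sqrt_zero] at this
    simpa using hu.add (hs.const_mul 2)
  have h0 : Tendsto (fun K => u K * (1 + Real.posLog (u K)⁻¹)) atTop (𝓝 0) := by
    refine squeeze_zero (fun K => mul_nonneg (hu0 K) (add_nonneg zero_le_one Real.posLog_nonneg)) (fun K => ?_) hg
    have := mul_posLog_inv_le_two_sqrt (hu0 K)
    nlinarith
  simpa [mul_assoc] using h0.const_mul C

end Tail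

/-! ## §5.2 At the scheme: the rate under `Target` alone [bookkeeping] -/

section Scheme

variable {G : Type*} [GaugeGroup G] [MeasurableSpace G] [RegularGaugeGroup G] [HaarData G] {O : Type*}
  (S : TorusScheme G O) (hβ : ∀ K, 0 ≤ S.β K) (hm : ∀ K o, Measurable (S.obs K o))
  (h1 : ∀ K o U, |S.obs K o U| ≤ 1)
include hβ hm h1

/-- **THE PAIR `(K, K+n)`, UNIFORMLY IN `n`.**  Under `MatchingModConstants vol l₀ δ (schemeZ S os)` (`0 < l₀`) with `Summable δ`, for every `K` and `n`
`|S.expectAt (K+n) os − S.expectAt K os| ≤ (4·e^{1+l₀}∕l₀)·τ_K·(1 + log⁺ τ_K⁻¹)`, `τ_K = Σ_m 2·vol·δ_{K+m}` — the analysis half's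
`abs_integral_sub_integral_le_linlog_of_cgf_close` for `F_K`, `F_{K+n}` (bounded by `1`) under the two Gibbs measures with `ε = τ_K`
(`abs_genFun_add_sub_le_tail`, `genFun_schemeZ_eq_cgf`, `expectAt_eq_integral_gibbs`). [folklore] -/
theorem abs_expectAt_add_sub_le_linlog_tail {vol l₀ : ℝ} {δ : ℕ → ℝ} (hl₀ : 0 < l₀) (os : List O)
    (hM : MatchingModConstants vol l₀ δ (schemeZ S os)) (hδ : Summable δ) (K n : ℕ) :
    |S.expectAt (K + n) os - S.expectAt K os| ≤
      4 * Real.exp (1 + l₀) / l₀ * (∑' m, 2 * (vol * δ (K + m))) *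
        (1 + Real.posLog (∑' m, 2 * (vol * δ (K + m)))⁻¹) := by
  haveI hP : ∀ K, IsProbabilityMeasure (T4GenFunBounds.gibbsMeasure (G := G) (S.P K) (S.β K)) := fun K =>
    T4GenFunBounds.isProbabilityMeasure_gibbsMeasure (G := G) (S.P K) (hβ K)
  have hτ0 : 0 ≤ ∑' m, 2 * (vol * δ (K + m)) :=
    tsum_nonneg fun m => mul_nonneg two_pos.le (mul_nonneg_of_matchingModConstants hl₀.le hM (K + m))
  have hmeas : ∀ K, AEMeasurable (prodObs S K os) (T4GenFunBounds.gibbsMeasure (S.P K) (S.β K)) := fun K =>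
    (T4GenFunBounds.measurable_prodObs S hm K os).aemeasurable
  have hbd : ∀ K, ∀ᵐ U ∂(T4GenFunBounds.gibbsMeasure (G := G) (S.P K) (S.β K)), |prodObs S K os U| ≤ 1 := fun K =>
    Eventually.of_forall (T4GenFunBounds.abs_prodObs_le_one S h1 K os)
  have hε : ∀ t : ℝ, |t| < l₀ →
      |cgf (prodObs S (K + n) os) (T4GenFunBounds.gibbsMeasure (S.P (K + n)) (S.β (K + n))) t -
        cgf (prodObs S K os) (T4GenFunBounds.gibbsMeasure (S.P K) (S.β K)) t| ≤ ∑' m, 2 * (vol * δ (K + m)) :=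
    fun t ht => by
      rw [← T4GenFunBounds.genFun_schemeZ_eq_cgf S hβ hm h1, ← T4GenFunBounds.genFun_schemeZ_eq_cgf S hβ hm h1]
      exact abs_genFun_add_sub_le_tail hM hl₀.le hδ ht.le K n
  have key := abs_integral_sub_integral_le_linlog_of_cgf_close (hmeas K) (hmeas (K + n)) (hbd K) (hbd (K + n)) hl₀
    hτ0 hε
  rw [← T4GenFunBounds.expectAt_eq_integral_gibbs S hβ, ← T4GenFunBounds.expectAt_eq_integral_gibbs S hβ, mul_one] at key
  refine key.trans (le_of_eq ?_)
  ring

/-- **THE RATE UNDER `Target` ALONE.**  If a string's dressed partition functions carry N19's DECL target `Spine.NE7.Target vol l₀ δ (schemeZ S os)`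
(matching modulo constants on the real segment `|t| ≤ l₀`, `0 < l₀`, AND `Summable δ` — nothing else), then the string's expectations converge to a limit
`E` and, for EVERY `K`, `|S.expectAt K os − E| ≤ (4·e^{1+l₀}∕l₀)·τ_K·(1 + log⁺ τ_K⁻¹)` with `τ_K = Σ_m 2·vol·δ_{K+m}`: the pair bound is uniform in `n`,
`τ_K → 0` (`tendsto_sum_nat_add`), so the expectations are Cauchy (`Metric.cauchySeq_iff'`) and the bound passes to the limit (`le_of_tendsto'`).
`Target` is a HYPOTHESIS (NOT PRINTED, NOT proved). [folklore] -/
theorem abs_expectAt_sub_lim_le_linlog_tail_of_target {vol l₀ : ℝ} {δ : ℕ → ℝ} (hl₀ : 0 < l₀) (os : List O)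
    (hT : NE7.Target vol l₀ δ (schemeZ S os)) :
    ∃ E : ℝ, Tendsto (fun K => S.expectAt K os) atTop (𝓝 E) ∧
      ∀ K, |S.expectAt K os - E| ≤
        4 * Real.exp (1 + l₀) / l₀ * (∑' m, 2 * (vol * δ (K + m))) *
          (1 + Real.posLog (∑' m, 2 * (vol * δ (K + m)))⁻¹) := by
  obtain ⟨hM, hδ⟩ := hT
  set τ : ℕ → ℝ := fun K => ∑' m, 2 * (vol * δ (K + m)) with hτ
  have hτ0 : ∀ K, 0 ≤ τ K := fun K =>
    tsum_nonneg fun m => mul_nonneg two_pos.le (mul_nonneg_of_matchingModConstants hl₀.le hM (K + m))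
  have hτlim : Tendsto τ atTop (𝓝 0) := by
    have h := tendsto_sum_nat_add fun j => 2 * (vol * δ j)
    have e : (fun i : ℕ => ∑' k : ℕ, 2 * (vol * δ (k + i))) = τ := by
      funext i
      show (∑' k : ℕ, 2 * (vol * δ (k + i))) = ∑' m, 2 * (vol * δ (i + m))
      exact tsum_congr fun k => by rw [add_comm]
    rwa [e] at h
  have hg := tendsto_linlog_of_tendsto_zero hτ0 hτlim (4 * Real.exp (1 + l₀) / l₀)
  have hpair : ∀ K n, |S.expectAt (K + n) os - S.expectAt K os| ≤
      4 * Real.exp (1 + l₀) / l₀ * τ K * (1 + Real.posLog (τ K)⁻¹) := fun K n =>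
    abs_expectAt_add_sub_le_linlog_tail S hβ hm h1 hl₀ os hM hδ K n
  have hc : CauchySeq fun K => S.expectAt K os := by
    refine Metric.cauchySeq_iff'.2 fun ε hε => ?_
    obtain ⟨N, hN⟩ := (hg.eventually (Iio_mem_nhds hε)).exists
    refine ⟨N, fun n hn => ?_⟩
    obtain ⟨k, rfl⟩ := Nat.exists_eq_add_of_le hn
    rw [Real.dist_eq]
    exact (hpair N k).trans_lt hN
  obtain ⟨E, hE⟩ := cauchySeq_tendsto_of_complete hc
  refine ⟨E, hE, fun K => ?_⟩
  have hEK : Tendsto (fun n => S.expectAt (K + n) os) atTop (𝓝 E) := by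
    have h := (tendsto_add_atTop_iff_nat (f := fun j => S.expectAt j os) K).2 hE
    have e : (fun n => S.expectAt (n + K) os) = fun n => S.expectAt (K + n) os := by
      funext n; rw [add_comm]
    rwa [e] at h
  have habs : Tendsto (fun n => |S.expectAt (K + n) os - S.expectAt K os|) atTop (𝓝 |E - S.expectAt K os|) :=
    (hEK.sub_const _).abs
  rw [abs_sub_comm]
  exact le_of_tendsto' habs fun n => hpair K n

/-- **THE APEX's PER-STRING SHAPE, WITH RATES.**  `T4ApexVariance.StringwiseMatching S` (every string matches modulo constants at ITS OWN radius and volume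
factor with ITS OWN summable remainder) hands, per string, a limit of the expectations and the explicit rate of the previous theorem in that string's own
letters.  `StringwiseMatching` is a HYPOTHESIS. [folklore] -/
theorem stringwise_rate_of_stringwiseMatching (h : T4ApexVariance.StringwiseMatching S) (os : List O) :
    ∃ (l₀ vol : ℝ) (δ : ℕ → ℝ) (E : ℝ), 0 < l₀ ∧ Summable δ ∧ MatchingModConstants vol l₀ δ (schemeZ S os) ∧
      Tendsto (fun K => S.expectAt K os) atTop (𝓝 E) ∧
      ∀ K, |S.expectAt K os - E| ≤
        4 * Real.exp (1 + l₀) / l₀ * (∑' m, 2 * (vol * δ (K + m))) *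
          (1 + Real.posLog (∑' m, 2 * (vol * δ (K + m)))⁻¹) := by
  obtain ⟨l₀, vol, δ, hl₀, hδ, hM⟩ := h os
  obtain ⟨E, hE, hrate⟩ := abs_expectAt_sub_lim_le_linlog_tail_of_target S hβ hm h1 hl₀ os ⟨hM, hδ⟩
  exact ⟨l₀, vol, δ, E, hl₀, hδ, hM, hE, hrate⟩

/-- Cross-check (no novelty): `StringwiseMatching S ⇒ Missing.HasContinuumLimit S` by THIS road (two constants, no generating-function limit object);
the tree's `T4ApexVariance.hasContinuumLimit_of_stringwiseMatching` reaches the same conclusion by the genFun ∕ Vitali road. [folklore] -/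
theorem hasContinuumLimit_of_stringwiseMatching_twoConstants (h : T4ApexVariance.StringwiseMatching S) : HasContinuumLimit S :=
  fun os => by
    obtain ⟨_, _, _, E, _, _, _, hE, _⟩ := stringwise_rate_of_stringwiseMatching S hβ hm h1 h os
    exact ⟨E, hE⟩

end Scheme

end Summit.QuantumFields.YangMills.BalabanUVNodes.N19ExpectationCurrencyTwoConstantsRate

end
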